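import Summits.QuantumFields.GaugeBoot.ZdWordWalks
import HarnessLib

/-!
# The `1/N²` law with decidable side conditions only: plaquette walks discharged, word data cyclically reduced (gauge-boot, large-`N` supplement 19)

HONEST FRAMING (cell `pub-gaugeboot`, page 1 of every file): the venture produces certified bounds
on lattice expectations at stated coupling, gauge group, dimension and torus size; NOT a mass gap,
NOT a continuum limit, NOT a string tension; NOT large `N` unless marked CONDITIONAL; NOT
Yang–Mills-summit-bearing (barriers `FixedCouplingUltralocality`, `PerturbativeInvisibility`).
CONDITIONAL on the tree's named fact `shenZhuZhu_largeN_variance` (SZZ CMP 400 (2023) Cor. 1.5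
(1.12)); this file certifies no number and no planar certificate of the cell exists in the tree.

## Why this file (an erratum on the HYPOTHESES of supplement 9)

Supplement 9 (`PlanarBootstrapLargeNRate`) stated the `1/N²` law
`PlanarCertificate.obj_le_bound_add_div_sq_of_szz` with walk data `γP r ν ε` realising the plaquette
words `plaqWord a_r ν ε` of EVERY row `r` for EVERY axis `ν : Fin d` — including `ν = a_r`, where the
word `[a, a, a⁻¹, a⁻¹]` is degenerate (holonomy identically `1`) although it never enters a row (the
rows sum over `ν ≠ a_r` only).  A non-backtracking closed walk is a reduced edge word, and over
`SU(N)`, `N ≥ 2` (which contains free subgroups) a non-empty reduced edge word has a configuration with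
non-trivial holonomy; so for `N ≥ 2` the hypothesis `hholP r a_r ε` of supplement 9 cannot be met and
that theorem, while true, is idle for certificates with at least one row.  (Not formalised here; this
file simply removes the hypothesis.)  The same remark applies to `rowDefectSuN_le_of_szz` there.

## Content — the intended statements, with FEWER hypotheses

* ★★ `PlanarCertificate.rowDefectSuN_le_of_szz'` — the `SU(N)` row defect is `O(1/N²)` with NO
  plaquette-walk data: the plaquette words `P̃_{a,ν,ε}`, `ν ≠ a`, are realised by the non-backtracking
  plaquette walks of `PlanarPlaquetteWalks` (`Γ(P̃, P̃) ≤ 16/(c₀N²)`, both orientations), so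
  `ε_r(μ_N) ≤ (length(w_r) + |βt| Σ_{ν ≠ a_r} Σ_ε (2 n_r(n_r−3) + 8)/c₀) / N²`.
* ★★★ `PlanarCertificate.obj_le_bound_add_div_sq_of_szz'` — **THE `1/N²` LAW** (given SZZ (1.12),
  `d ≥ 2`, `|βt| < 1/(16(d−1))`): for a valid planar certificate whose relaxation loops and marked words
  are realised by non-backtracking closed walks at `x`, and every thermodynamic limit point `μ_N`
  (`N ≥ 1`) of the `SU(N)` torus Wilson states at tree coupling `N·βt` satisfying the identification
  rows, `obj(W_{μ_N}) ≤ bound + K'/N²` with the explicit `K' = szzRateConst'` (certificate data, walk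
  lengths, `c₀`; no plaquette-walk data).
* ★★★ `PlanarCertificate.obj_le_bound_add_div_sq_of_szz_of_cyclicallyReduced` — **THE `1/N²` LAW WITH
  DECIDABLE SIDE CONDITIONS ONLY**: if the relaxation loops and marked words are CYCLICALLY REDUCED
  closed words (`Word.CyclicallyReduced`, `decide` for concrete words; supplement 14's
  `isNonBacktrackingLoop_toLoopZd`), then `obj(W_{μ_N}) ≤ bound + K_w/N²` with `K_w = szzRateConstWords P`
  depending on the certificate's WORD DATA alone (word lengths, multipliers, `βt`, `d`).
* ★ `isNonBacktrackingLoop_toLoopZd_iff` — the walk of a closed word is a non-backtracking loop in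
  SZZ's sense IFF the word is cyclically reduced (supplement 14 proved `⇐`).

[folklore] bookkeeping on top of SZZ; Kazakov–Zheng arXiv:2203.11360.
-/

noncomputable section

open MeasureTheory ProbabilityTheory Filter Topology
open scoped BigOperators
open Literature.Probability.LatticeModels (Site zdGraph)
open Literature.MathematicalPhysics.QuantumLattice
open Literature.MathematicalPhysics.QuantumFieldTheory (szzThresholdSU shenZhuZhu_largeN_variance IsNonBacktrackingLoop)
open SimpleGraph

namespace Summit.QuantumFields.GaugeBoot

variable {d N : ℕ}

/-! ## Non-backtracking loop ⟺ cyclically reduced word -/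

/-- ★ **The closed walk of a closed word is a non-backtracking loop (SZZ) iff the word is cyclically
reduced.** [folklore] -/
theorem isNonBacktrackingLoop_toLoopZd_iff (x : Site d) (w : Word d) (hw : Word.endpointZd x w = x) :
    IsNonBacktrackingLoop (Word.toLoopZd x w hw) ↔ w.CyclicallyReduced := by
  refine ⟨fun h => ?_, isNonBacktrackingLoop_toLoopZd x w hw⟩
  obtain ⟨hlen, hchain⟩ := h
  rw [Word.length_toLoopZd] at hlen
  have hne : w ≠ [] := List.ne_nil_of_length_pos hlen
  refine ⟨hne, ?_⟩
  rw [Word.toLoopZd, Walk.darts_copy] at hchain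
  obtain ⟨s, w', rfl⟩ := List.exists_cons_of_ne_nil hne
  have htake : (Word.toWalkZd x (s :: w')).darts.take 1 = [stepDart x s] := by
    simp [Word.toWalkZd, stepDart]
  have e : stepDart (Word.endpointZd x (s :: w')) s = stepDart x s := by rw [hw]
  rw [htake, ← e, isChain_darts_toWalkZd_append] at hchain
  simpa using hchain

/-- Hence a closed word that is NOT cyclically reduced does not give a non-backtracking loop
(its walk backtracks somewhere, cyclically). [folklore] -/
theorem not_isNonBacktrackingLoop_toLoopZd (x : Site d) (w : Word d) (hw : Word.endpointZd x w = x)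
    (h : ¬ w.CyclicallyReduced) : ¬ IsNonBacktrackingLoop (Word.toLoopZd x w hw) :=
  fun h' => h ((isNonBacktrackingLoop_toLoopZd_iff x w hw).1 h')

/-! ## The row defect is `O(1/N²)` — plaquette walks discharged -/

namespace PlanarCertificate

variable (P : PlanarCertificate d)

/-- ★★ **The `SU(N)` row defect is `O(1/N²)`, with no plaquette-walk data** (given SZZ (1.12)):
`ε_r(μ_N) ≤ (length(w_r) + |βt| Σ_{ν ≠ a_r} Σ_ε (2 n_r(n_r−3) + 8)/c₀) / N²`, the plaquette words
`P̃_{a_r,ν,ε}`, `ν ≠ a_r`, being realised by the plaquette walks of `PlanarPlaquetteWalks`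
(`Γ(P̃,P̃) ≤ 16/(c₀N²)`). [cite: ShenZhuZhuCMP2023, Corollary 1.5] -/
theorem rowDefectSuN_le_of_szz' (hfact : ∀ N, shenZhuZhu_largeN_variance d N) (hd : 2 ≤ d)
    (hβ : |P.βt| < szzThresholdSU d) (hN : 1 ≤ N) {μ : Measure (LGConfig d (Matrix.specialUnitaryGroup (Fin N) ℂ))}
    (hμ : μ ∈ infiniteVolumeLimitPoints (d := d) (fundamentalRep (Fin N)) ((N : ℝ) * P.βt)) (x : Site d)
    (γR : (r : Fin P.nR) → (zdGraph d).Walk x x) (hγR : ∀ r, IsNonBacktrackingLoop (γR r))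
    (hholR : ∀ r (U : LGConfig d (Matrix.specialUnitaryGroup (Fin N) ℂ)), walkHolonomy U (γR r) = wordHolonomyZd U x (P.rowWord r))
    (r : Fin P.nR) :
    P.rowDefectSuN μ x r ≤
      (((P.rowWord r).length : ℝ) + |P.βt| * ∑ _ν ∈ Finset.univ.erase (P.rowAxis r), ∑ _ε : Bool,
        (2 * (((γR r).length : ℝ) * (((γR r).length : ℝ) - 3)) + 8) / szzPlanarSlope d P.βt) / (N : ℝ) ^ 2 := by
  haveI : IsProbabilityMeasure μ := by obtain ⟨L, -, hL⟩ := hμ; exact hL.1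
  have hww := loopImCov_le_of_szz hfact hd hβ hN hμ x _ (γR r) (hγR r) (hholR r)
  rw [rowDefectSuN, add_div, mul_div_assoc, Finset.sum_div]
  gcongr with ν hν
  rw [Finset.sum_div]
  gcongr with ε _
  have haν : P.rowAxis r ≠ ν := (Finset.ne_of_mem_erase hν).symm
  have hPP := loopImCov_plaqWord_le_of_szz hfact hd hβ hN hμ x haν ε
  refine (abs_loopImCov_le_half_add _ (continuous_fundamentalRep (Fin N)) μ x _ _).trans ?_
  rw [div_le_iff₀ (by norm_num : (0 : ℝ) < 2)]
  have hc : 0 < szzPlanarSlope d P.βt := szzPlanarSlope_pos hd hβ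
  have hNpos : (0 : ℝ) < N := by exact_mod_cast hN
  calc loopImCov (fundamentalRep (Fin N)) μ x (P.rowWord r) (P.rowWord r) +
        loopImCov (fundamentalRep (Fin N)) μ x (plaqWord (P.rowAxis r) ν ε) (plaqWord (P.rowAxis r) ν ε)
      ≤ 4 * (((γR r).length : ℝ) * (((γR r).length : ℝ) - 3)) / szzPlanarSlope d P.βt / (N : ℝ) ^ 2 +
          16 / szzPlanarSlope d P.βt / (N : ℝ) ^ 2 := add_le_add hww hPP
    _ = _ := by field_simp; ring

/-- **The explicit `1/N²` constant, no plaquette-walk data** (certificate data, walk lengths of the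
marked words and relaxation loops, `c₀`). [folklore] -/
def szzRateConst' (x : Site d) (γS : (A : Fin P.nI) → (zdGraph d).Walk x x) (γR : (r : Fin P.nR) → (zdGraph d).Walk x x) : ℝ :=
  (∑ r, |P.rowMult r| * (((P.rowWord r).length : ℝ) + |P.βt| * ∑ _ν ∈ Finset.univ.erase (P.rowAxis r), ∑ _ε : Bool,
      (2 * (((γR r).length : ℝ) * (((γR r).length : ℝ) - 3)) + 8) / szzPlanarSlope d P.βt)) +
    ∑ s, (P.nI : ℝ) * ∑ A, P.shorVec s A ^ 2 * (4 * (((γS A).length : ℝ) * (((γS A).length : ℝ) - 3)) / szzPlanarSlope d P.βt)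

/-- ★★★ **THE `1/N²` LAW (given SZZ (1.12)), plaquette walks discharged.**  `d ≥ 2`,
`|βt| < 1/(16(d−1))`; `P` a valid planar certificate at `βt`; its relaxation loops `ℓ_A` and marked
words `w_r` realised by non-backtracking closed walks at `x` (Gram words and rows closed at `x`); `μ_N`
(`N ≥ 1`) ANY thermodynamic limit point of the `SU(N)` torus Wilson states at tree coupling `N·βt`
satisfying the identification rows.  Then `obj(W_{μ_N}) ≤ bound + K'/N²`, `K' = szzRateConst'`.
[cite: ShenZhuZhuCMP2023, Corollary 1.5] -/
theorem obj_le_bound_add_div_sq_of_szz' (hP : P.IsValid) (hfact : ∀ N, shenZhuZhu_largeN_variance d N)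
    (hd : 2 ≤ d) (hβ : |P.βt| < szzThresholdSU d) (hN : 1 ≤ N)
    {μ : Measure (LGConfig d (Matrix.specialUnitaryGroup (Fin N) ℂ))}
    (hμ : μ ∈ infiniteVolumeLimitPoints (d := d) (fundamentalRep (Fin N)) ((N : ℝ) * P.βt)) (x : Site d)
    (hrow : ∀ r, Word.endpointZd x (P.rowWord r) = x) (hgram : ∀ j i, Word.endpointZd x (P.gramWord j i) = x)
    (hlin : ∀ e, P.lin e (loopW (fundamentalRep (Fin N)) μ x) (loopQ (fundamentalRep (Fin N)) μ x) = 0)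
    (γS : (A : Fin P.nI) → (zdGraph d).Walk x x) (hγS : ∀ A, IsNonBacktrackingLoop (γS A))
    (hholS : ∀ A (U : LGConfig d (Matrix.specialUnitaryGroup (Fin N) ℂ)), walkHolonomy U (γS A) = wordHolonomyZd U x (P.shorLoop A))
    (γR : (r : Fin P.nR) → (zdGraph d).Walk x x) (hγR : ∀ r, IsNonBacktrackingLoop (γR r))
    (hholR : ∀ r (U : LGConfig d (Matrix.specialUnitaryGroup (Fin N) ℂ)), walkHolonomy U (γR r) = wordHolonomyZd U x (P.rowWord r)) :
    P.obj (loopW (fundamentalRep (Fin N)) μ x) ≤ P.bound + P.szzRateConst' x γS γR / (N : ℝ) ^ 2 := by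
  haveI : SecondCountableTopology (Matrix (Fin N) (Fin N) ℂ) :=
    inferInstanceAs (SecondCountableTopology (Fin N → Fin N → ℂ))
  haveI : SecondCountableTopology (Matrix.specialUnitaryGroup (Fin N) ℂ) :=
    Topology.IsEmbedding.subtypeVal.secondCountableTopology
  have hβ' : (N : ℝ) * P.βt / N = P.βt := natCast_mul_div_natCast hN P.βt
  have h := P.obj_loopW_le_suN_of_mem_infiniteVolumeLimitPoints hP hβ' hμ x hrow hgram hlin
  refine h.trans ?_
  rw [add_assoc, szzRateConst', add_div, Finset.sum_div, Finset.sum_div]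
  gcongr with r _ s _
  · rw [mul_div_assoc]
    gcongr
    exact P.rowDefectSuN_le_of_szz' hfact hd hβ hN hμ x γR hγR hholR r
  · exact P.shorDefect_le_of_szz hfact hd hβ hN hμ x γS hγS hholS s

/-! ## Cyclically reduced word data: no walk data at all -/

/-- **The `1/N²` constant from the certificate's WORD DATA alone**: word lengths of the marked words
and relaxation loops, multipliers, `βt`, `d`. [folklore] -/
def szzRateConstWords : ℝ :=
  (∑ r, |P.rowMult r| * (((P.rowWord r).length : ℝ) + |P.βt| * ∑ _ν ∈ Finset.univ.erase (P.rowAxis r), ∑ _ε : Bool,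
      (2 * (((P.rowWord r).length : ℝ) * (((P.rowWord r).length : ℝ) - 3)) + 8) / szzPlanarSlope d P.βt)) +
    ∑ s, (P.nI : ℝ) * ∑ A, P.shorVec s A ^ 2 *
      (4 * (((P.shorLoop A).length : ℝ) * (((P.shorLoop A).length : ℝ) - 3)) / szzPlanarSlope d P.βt)

/-- With the walks of the words themselves, `szzRateConst'` is `szzRateConstWords`. [folklore] -/
theorem szzRateConst'_toLoopZd (x : Site d) (hS : ∀ A, Word.endpointZd x (P.shorLoop A) = x)
    (hrow : ∀ r, Word.endpointZd x (P.rowWord r) = x) :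
    P.szzRateConst' x (fun A => Word.toLoopZd x (P.shorLoop A) (hS A)) (fun r => Word.toLoopZd x (P.rowWord r) (hrow r)) =
      P.szzRateConstWords := by
  simp only [szzRateConst', szzRateConstWords, Word.length_toLoopZd]

/-- ★★★ **THE `1/N²` LAW WITH DECIDABLE SIDE CONDITIONS ONLY (given SZZ (1.12)).**  `d ≥ 2`,
`|βt| < 1/(16(d−1))`; `P` a valid planar certificate at `βt` whose relaxation loops and marked words are
CYCLICALLY REDUCED words closed at `x` (Gram words closed at `x`); `μ_N` (`N ≥ 1`) ANY thermodynamic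
limit point of the `SU(N)` torus Wilson states at tree coupling `N·βt` satisfying the identification rows.
Then `obj(W_{μ_N}) ≤ bound + K_w/N²` with `K_w = szzRateConstWords P` — no walk data anywhere.
[cite: ShenZhuZhuCMP2023, Corollary 1.5] -/
theorem obj_le_bound_add_div_sq_of_szz_of_cyclicallyReduced (hP : P.IsValid) (hfact : ∀ N, shenZhuZhu_largeN_variance d N)
    (hd : 2 ≤ d) (hβ : |P.βt| < szzThresholdSU d) (hN : 1 ≤ N)
    {μ : Measure (LGConfig d (Matrix.specialUnitaryGroup (Fin N) ℂ))}
    (hμ : μ ∈ infiniteVolumeLimitPoints (d := d) (fundamentalRep (Fin N)) ((N : ℝ) * P.βt)) (x : Site d)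
    (hrow : ∀ r, Word.endpointZd x (P.rowWord r) = x) (hgram : ∀ j i, Word.endpointZd x (P.gramWord j i) = x)
    (hS : ∀ A, Word.endpointZd x (P.shorLoop A) = x)
    (hredR : ∀ r, (P.rowWord r).CyclicallyReduced) (hredS : ∀ A, (P.shorLoop A).CyclicallyReduced)
    (hlin : ∀ e, P.lin e (loopW (fundamentalRep (Fin N)) μ x) (loopQ (fundamentalRep (Fin N)) μ x) = 0) :
    P.obj (loopW (fundamentalRep (Fin N)) μ x) ≤ P.bound + P.szzRateConstWords / (N : ℝ) ^ 2 := by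
  rw [← P.szzRateConst'_toLoopZd x hS hrow]
  exact P.obj_le_bound_add_div_sq_of_szz' hP hfact hd hβ hN hμ x hrow hgram hlin
    (fun A => Word.toLoopZd x (P.shorLoop A) (hS A)) (fun A => isNonBacktrackingLoop_toLoopZd x _ (hS A) (hredS A))
    (fun A U => walkHolonomy_toLoopZd U x _ (hS A))
    (fun r => Word.toLoopZd x (P.rowWord r) (hrow r)) (fun r => isNonBacktrackingLoop_toLoopZd x _ (hrow r) (hredR r))
    (fun r U => walkHolonomy_toLoopZd U x _ (hrow r))

/-- ★★ **The qualitative form with decidable side conditions**: for cyclically reduced data,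
`∀ δ > 0`, eventually in `N`, `obj(W_{μ_N}) ≤ bound + δ` along ANY thermodynamic limit points `μ_N` of
the `SU(N)` torus states at tree coupling `N·βt` satisfying the identification rows (given SZZ (1.12),
`d ≥ 2`, `|βt| < 1/(16(d−1))`). [cite: ShenZhuZhuCMP2023, Corollary 1.5] -/
theorem eventually_obj_le_of_szz_of_cyclicallyReduced (hP : P.IsValid) (hfact : ∀ N, shenZhuZhu_largeN_variance d N)
    (hd : 2 ≤ d) (hβ : |P.βt| < szzThresholdSU d)
    (μ : (N : ℕ) → Measure (LGConfig d (Matrix.specialUnitaryGroup (Fin N) ℂ)))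
    (hμ : ∀ N, 1 ≤ N → μ N ∈ infiniteVolumeLimitPoints (d := d) (fundamentalRep (Fin N)) ((N : ℝ) * P.βt)) (x : Site d)
    (hrow : ∀ r, Word.endpointZd x (P.rowWord r) = x) (hgram : ∀ j i, Word.endpointZd x (P.gramWord j i) = x)
    (hS : ∀ A, Word.endpointZd x (P.shorLoop A) = x)
    (hredR : ∀ r, (P.rowWord r).CyclicallyReduced) (hredS : ∀ A, (P.shorLoop A).CyclicallyReduced)
    (hlin : ∀ N e, P.lin e (loopW (fundamentalRep (Fin N)) (μ N) x) (loopQ (fundamentalRep (Fin N)) (μ N) x) = 0)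
    {δ : ℝ} (hδ : 0 < δ) :
    ∀ᶠ N in atTop, P.obj (loopW (fundamentalRep (Fin N)) (μ N) x) ≤ P.bound + δ := by
  -- `K_w / N² → 0`
  have hlim : Tendsto (fun N : ℕ => P.szzRateConstWords / (N : ℝ) ^ 2) atTop (𝓝 0) := by
    have h2 : Tendsto (fun N : ℕ => ((N : ℝ) ^ 2)⁻¹) atTop (𝓝 0) := by
      have := (tendsto_pow_atTop (α := ℝ) (n := 2) (by norm_num)).comp tendsto_natCast_atTop_atTop
      exact this.inv_tendsto_atTop
    have := h2.const_mul P.szzRateConstWords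
    simpa [div_eq_mul_inv] using this
  have hev : ∀ᶠ N : ℕ in atTop, P.szzRateConstWords / (N : ℝ) ^ 2 < δ :=
    (tendsto_order.1 hlim).2 δ hδ
  filter_upwards [hev, eventually_ge_atTop 1] with N hN hN1
  exact (P.obj_le_bound_add_div_sq_of_szz_of_cyclicallyReduced hP hfact hd hβ hN1 (hμ N hN1) x hrow hgram hS hredR hredS
    (hlin N)).trans (by linarith)

end PlanarCertificate

end Summit.QuantumFields.GaugeBoot

end
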